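import Mathlib.Analysis.InnerProductSpace.Completion
import Mathlib.Analysis.InnerProductSpace.Positive
import Mathlib.Topology.Algebra.LinearMapCompletion
import Literature.Probability.LatticeModels.TransferOperator
import HarnessLib

/-!
# Osterwalder–Schrader reconstruction, abstract layer: Hilbert space, vacuum and transfer operator from a
# positive-semidefinite Hermitian form with a symmetric, orbit-bounded endomorphism

`TransferOperator.lean` packages the OUTPUT of the Osterwalder–Schrader reconstruction as hypothesis structures
(`TransferData`, `IsOSRealisation`) and defers the construction itself ("the GNS quotient … deferred").  This file
performs the construction at the level of linear algebra / functional analysis (Glimm–Jaffe 1987 §6.1, Thm. 6.1.3;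
Osterwalder–Seiler 1978 §2; Seiler LNP 159 Ch. 2), for the data one reads off a reflection-positive, translation
invariant lattice functional:

* a complex vector space `V` (think: bounded positive-time observables) with a positive-SEMIdefinite Hermitian form
  `c : PreInnerProductSpace.Core ℂ V` (the reflected pairing `⟨θF̄ · G⟩`);
* a linear endomorphism `S` of `V` (time translation by one unit) which is SYMMETRIC for the form and has BOUNDED
  ORBITS `‖Sⁿ v‖ ≤ C_v` (for a probability measure: `⟨θF̄ₙ · Fₙ⟩ ≤ ‖F‖_∞²`);
* a vector `e` with `S e = e`, `c.inner e e = 1` (the unit observable).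

Output: the Hilbert space `OSHilbert c` (completion of the separation quotient of the seminormed pre-inner-product space
`OSPre c` — Mathlib's `InnerProductSpace.ofCore`, `SeparationQuotient`, `UniformSpace.Completion`), the linear map
`osMap c : V →ₗ[ℂ] OSHilbert c` with `⟪osMap u, osMap v⟫ = c.inner u v` and dense range, and — the one analytic point —
**the iterated Schwarz inequality** `norm_map_le_of_symm_of_orbitBounded`: symmetry + bounded orbits force `S` to be a
CONTRACTION for the seminorm (Glimm–Jaffe Thm. 6.1.3 (iii)), so that `S` descends and extends to a self-adjoint
contraction `osOperator` on `OSHilbert c` intertwined by `osMap` (`osOperator_osMap`); if moreover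
`0 ≤ re c.inner (S v) v` it is a positive operator, and `osTransferData` bundles `(osOperator, osMap e)` as
`TransferData`.  The measure-theoretic instantiation (`IsOSRealisation` for a reflection-positive measure) is a
separate file.

Nothing here is specific to lattice models; Mathlib has the completion of an inner product space and the extension of
continuous linear maps to completions, but not this packaged construction. [cite: GlimmJaffe1987, §6.1 Thm. 6.1.3]
[cite: OsterwalderSeiler1978, §2] [cite: Seiler1982, Ch. 2]
-/

noncomputable section

open scoped InnerProductSpace ComplexConjugate
open UniformSpace Filter

namespace Literature.Probability.LatticeModels

universe u

variable {V : Type u} [AddCommGroup V] [Module ℂ V]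

/-- **The pre-Hilbert space of the OS form**: a type synonym of `V` carrying the seminormed inner-product-space
structure defined by the positive-semidefinite Hermitian form `c` (Mathlib `InnerProductSpace.ofCore`).
[cite: GlimmJaffe1987, §6.1 Thm. 6.1.3] -/
def OSPre (_c : PreInnerProductSpace.Core ℂ V) : Type u := V

namespace OSPre

variable (c : PreInnerProductSpace.Core ℂ V)

/-- The additive group structure of `V`, transported to the synonym. [folklore] -/
instance : AddCommGroup (OSPre c) := inferInstanceAs (AddCommGroup V)

/-- The `ℂ`-module structure of `V`, transported to the synonym. [folklore] -/
instance : Module ℂ (OSPre c) := inferInstanceAs (Module ℂ V)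

/-- The form `c` read on the synonym. [folklore] -/
@[reducible] def core : PreInnerProductSpace.Core ℂ (OSPre c) := c

/-- The seminorm `‖x‖ = √(re c.inner x x)` of the form (Mathlib `InnerProductSpace.Core.toSeminormedAddCommGroup`;
no other norm lives on the synonym). [cite: GlimmJaffe1987, §6.1 Thm. 6.1.3] -/
instance : SeminormedAddCommGroup (OSPre c) :=
  @InnerProductSpace.Core.toSeminormedAddCommGroup ℂ (OSPre c) _ _ _ (core c)

/-- The (semi-)inner-product-space structure of the form (Mathlib `InnerProductSpace.ofCore`).
[cite: GlimmJaffe1987, §6.1 Thm. 6.1.3] -/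
instance : InnerProductSpace ℂ (OSPre c) :=
  @InnerProductSpace.ofCore ℂ (OSPre c) _ _ _ (core c)

/-- The identity `V → OSPre c`. [folklore] -/
def of : V →ₗ[ℂ] OSPre c := LinearMap.id

/-- The inner product of the synonym is the form. [folklore] -/
@[simp] theorem inner_of (u v : V) : ⟪of c u, of c v⟫_ℂ = c.inner u v := rfl

/-- An endomorphism of `V` read on the synonym. [folklore] -/
def endo (S : V →ₗ[ℂ] V) : OSPre c →ₗ[ℂ] OSPre c := S

/-- `endo` and `of` commute with `S`. [folklore] -/
@[simp] theorem endo_of (S : V →ₗ[ℂ] V) (v : V) : endo c S (of c v) = of c (S v) := rfl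

end OSPre

/-! ### The iterated Schwarz inequality: symmetric + bounded orbits ⇒ contraction -/

section Schwarz

variable {E : Type*} [SeminormedAddCommGroup E] [InnerProductSpace ℂ E]

/-- Powers of a symmetric endomorphism are symmetric for the (semi-)inner product. [folklore] -/
theorem inner_pow_apply_left_eq_right' {S : E →ₗ[ℂ] E} (hS : ∀ x y : E, ⟪S x, y⟫_ℂ = ⟪x, S y⟫_ℂ)
    (n : ℕ) (x y : E) : ⟪(S ^ n) x, y⟫_ℂ = ⟪x, (S ^ n) y⟫_ℂ := by
  induction n generalizing x y with
  | zero => simp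
  | succ n ih =>
    calc ⟪(S ^ (n + 1)) x, y⟫_ℂ = ⟪S ((S ^ n) x), y⟫_ℂ := by rw [pow_succ', Module.End.mul_apply]
      _ = ⟪(S ^ n) x, S y⟫_ℂ := hS _ _
      _ = ⟪x, (S ^ n) (S y)⟫_ℂ := ih _ _
      _ = ⟪x, (S ^ (n + 1)) y⟫_ℂ := by rw [pow_succ, Module.End.mul_apply]

/-- **Iterated Schwarz inequality** (Glimm–Jaffe 1987, proof of Thm. 6.1.3 (iii)): in a SEMInormed complex inner
product space, a symmetric endomorphism `S` whose orbit `n ↦ ‖Sⁿ v‖` is bounded does not increase the seminorm of `v`: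
`‖S v‖ ≤ ‖v‖`.  Proof: `‖Sⁿ v‖² = re ⟪v, S²ⁿ v⟫ ≤ ‖v‖ ‖S²ⁿ v‖`, iterated along `n = 1, 2, 4, …` gives
`‖S v‖^{2^k} ‖v‖ ≤ ‖S^{2^k} v‖ ‖v‖^{2^k} ≤ C ‖v‖^{2^k}`, impossible for large `k` if `‖S v‖ > ‖v‖`.
[cite: GlimmJaffe1987, §6.1 Thm. 6.1.3 (iii)] -/
theorem norm_map_le_of_symm_of_orbitBounded {S : E →ₗ[ℂ] E} (hS : ∀ x y : E, ⟪S x, y⟫_ℂ = ⟪x, S y⟫_ℂ)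
    (v : E) {C : ℝ} (hC : ∀ n : ℕ, ‖(S ^ n) v‖ ≤ C) : ‖S v‖ ≤ ‖v‖ := by
  -- the norms `b n = ‖Sⁿ v‖`
  set b : ℕ → ℝ := fun n => ‖(S ^ n) v‖ with hb
  have hb0 : ∀ n, 0 ≤ b n := fun n => norm_nonneg _
  -- `b n ^ 2 = re ⟪v, S^(2n) v⟫`
  have hsq : ∀ n, b n ^ 2 = RCLike.re ⟪v, (S ^ (2 * n)) v⟫_ℂ := fun n => by
    change ‖(S ^ n) v‖ ^ 2 = _
    rw [two_mul, pow_add, Module.End.mul_apply, ← inner_pow_apply_left_eq_right' hS,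
      inner_self_eq_norm_sq]
  -- Schwarz: `b n ^ 2 ≤ ‖v‖ b (2n)`
  have key1 : ∀ n, b n ^ 2 ≤ ‖v‖ * b (2 * n) := fun n => by
    rw [hsq]
    exact (RCLike.re_le_norm _).trans (norm_inner_le_norm _ _)
  have hb1 : ‖S v‖ = b 1 := by change ‖S v‖ = ‖(S ^ 1) v‖; rw [pow_one]
  rw [hb1]
  -- the case `‖v‖ = 0`
  rcases (norm_nonneg v).eq_or_lt with hv0 | hv0
  · have h1 := key1 1
    rw [← hv0, zero_mul] at h1
    have : b 1 = 0 := pow_eq_zero_iff two_ne_zero |>.mp (le_antisymm h1 (sq_nonneg _))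
    rw [this, ← hv0]
  -- doubling: from exponent `N` to `2N`
  have step : ∀ N : ℕ, b 1 ^ N * ‖v‖ ≤ b N * ‖v‖ ^ N →
      b 1 ^ (2 * N) * ‖v‖ ≤ b (2 * N) * ‖v‖ ^ (2 * N) := by
    intro N ih
    have ih2 : (b 1 ^ N * ‖v‖) ^ 2 ≤ (b N * ‖v‖ ^ N) ^ 2 :=
      pow_le_pow_left₀ (mul_nonneg (pow_nonneg (hb0 1) N) (norm_nonneg v)) ih 2
    have h5 : (b N * ‖v‖ ^ N) ^ 2 ≤ ‖v‖ * b (2 * N) * (‖v‖ ^ N) ^ 2 := by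
      rw [mul_pow]
      exact mul_le_mul_of_nonneg_right (key1 N) (pow_nonneg (pow_nonneg (norm_nonneg v) N) 2)
    have h6 : b 1 ^ (2 * N) * ‖v‖ * ‖v‖ ≤ b (2 * N) * ‖v‖ ^ (2 * N) * ‖v‖ := by
      calc b 1 ^ (2 * N) * ‖v‖ * ‖v‖ = (b 1 ^ N * ‖v‖) ^ 2 := by ring
        _ ≤ ‖v‖ * b (2 * N) * (‖v‖ ^ N) ^ 2 := ih2.trans h5
        _ = b (2 * N) * ‖v‖ ^ (2 * N) * ‖v‖ := by ring
    exact le_of_mul_le_mul_right h6 hv0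
  have iter : ∀ k : ℕ, b 1 ^ (2 ^ k) * ‖v‖ ≤ b (2 ^ k) * ‖v‖ ^ (2 ^ k) := by
    intro k
    induction k with
    | zero => simp
    | succ k ih => rw [pow_succ']; exact step _ ih
  -- insert the orbit bound: `b 1 ^ (2^k) ‖v‖ ≤ C ‖v‖ ^ (2^k)`
  have final : ∀ k : ℕ, b 1 ^ (2 ^ k) * ‖v‖ ≤ C * ‖v‖ ^ (2 ^ k) := fun k =>
    (iter k).trans (mul_le_mul_of_nonneg_right (hC _) (pow_nonneg (norm_nonneg v) _))
  -- conclude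
  refine not_lt.mp fun hlt => ?_
  have hs : 1 < b 1 / ‖v‖ := (one_lt_div hv0).mpr hlt
  obtain ⟨k, hk⟩ := ((tendsto_pow_atTop_atTop_of_one_lt hs).eventually_gt_atTop (C / ‖v‖)).exists
  have hle : k ≤ 2 ^ k := Nat.lt_two_pow_self.le
  have h1 : C / ‖v‖ < (b 1 / ‖v‖) ^ (2 ^ k) := hk.trans_le (pow_le_pow_right₀ hs.le hle)
  have h2 := final k
  rw [div_pow, lt_div_iff₀ (pow_pos hv0 _), div_mul_eq_mul_div, div_lt_iff₀ hv0] at h1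
  -- `h1 : C * ‖v‖ ^ 2^k < b 1 ^ 2^k * ‖v‖`
  linarith

end Schwarz

/-! ### The Hilbert space, the map `ι` and its basic properties -/

section Space

variable (c : PreInnerProductSpace.Core ℂ V)

/-- **The OS Hilbert space** of the form `c`: the completion of the separation quotient (quotient by the null space)
of the seminormed pre-inner-product space `OSPre c`. [cite: GlimmJaffe1987, §6.1 Thm. 6.1.3] -/
abbrev OSHilbert : Type u := Completion (SeparationQuotient (OSPre c))

/-- **The OS map `ι : V → 𝓗`** (class of an observable). [cite: GlimmJaffe1987, §6.1 Thm. 6.1.3] -/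
def osMap : V →ₗ[ℂ] OSHilbert c :=
  (Completion.toComplL : SeparationQuotient (OSPre c) →L[ℂ] OSHilbert c).toLinearMap ∘ₗ
    (SeparationQuotient.mkCLM ℂ (OSPre c)).toLinearMap ∘ₗ OSPre.of c

/-- `ι v` is the class of `v` in the completion of the separation quotient. [folklore] -/
theorem osMap_apply (v : V) :
    osMap c v = ((SeparationQuotient.mk (OSPre.of c v) : SeparationQuotient (OSPre c)) : OSHilbert c) := rfl

/-- **The inner product of `𝓗` is the form**: `⟪ι u, ι v⟫ = c.inner u v`. [cite: GlimmJaffe1987, §6.1 Thm. 6.1.3] -/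
@[simp] theorem inner_osMap (u v : V) : ⟪osMap c u, osMap c v⟫_ℂ = c.inner u v := by
  rw [osMap_apply, osMap_apply, Completion.inner_coe, SeparationQuotient.inner_mk_mk, OSPre.inner_of]

/-- `‖ι v‖` is the OS seminorm of `v`. [folklore] -/
theorem norm_osMap (v : V) : ‖osMap c v‖ = ‖OSPre.of c v‖ := by
  rw [osMap_apply, Completion.norm_coe, SeparationQuotient.norm_mk]

/-- `‖ι v‖² = re c.inner v v`. [folklore] -/
theorem norm_osMap_sq (v : V) : ‖osMap c v‖ ^ 2 = RCLike.re (c.inner v v) := by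
  rw [norm_osMap, ← @inner_self_eq_norm_sq ℂ (OSPre c)]
  rfl

/-- **The range of `ι` is dense in `𝓗`.** [cite: GlimmJaffe1987, §6.1 Thm. 6.1.3] -/
theorem denseRange_osMap : DenseRange (osMap c) := by
  have h1 : DenseRange ((↑) : SeparationQuotient (OSPre c) → OSHilbert c) := Completion.denseRange_coe
  have h2 : Function.Surjective
      (fun v : V => (SeparationQuotient.mk (OSPre.of c v) : SeparationQuotient (OSPre c))) :=
    fun q => by
      obtain ⟨x, rfl⟩ := SeparationQuotient.surjective_mk q
      exact ⟨x, rfl⟩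
  exact h1.comp h2.denseRange (Completion.continuous_coe _)

end Space

/-! ### The operator: a seminorm contraction descends to the quotient and extends to the completion -/

section Operator

variable (c : PreInnerProductSpace.Core ℂ V) (S : V →ₗ[ℂ] V)
  (hS : ∀ x : OSPre c, ‖OSPre.endo c S x‖ ≤ ‖x‖)

/-- A seminorm contraction of `OSPre c` as a continuous linear map. [folklore] -/
def preOp : OSPre c →L[ℂ] OSPre c :=
  (OSPre.endo c S).mkContinuous 1 fun x => by simpa using hS x

/-- `preOp` acts as `S`. [folklore] -/
@[simp] theorem preOp_apply (x : OSPre c) : preOp c S hS x = OSPre.endo c S x := rfl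

/-- The contraction respects inseparability (it maps the null space into itself). [folklore] -/
theorem preOp_inseparable {x y : OSPre c} (h : Inseparable x y) :
    Inseparable (preOp c S hS x) (preOp c S hS y) := by
  rw [Metric.inseparable_iff, dist_eq_norm] at h ⊢
  rw [preOp_apply, preOp_apply, ← map_sub]
  exact le_antisymm ((hS _).trans h.le) (norm_nonneg _)

/-- The contraction on the separation quotient. [folklore] -/
def quotOp : SeparationQuotient (OSPre c) →L[ℂ] SeparationQuotient (OSPre c) :=
  SeparationQuotient.liftCLM ((SeparationQuotient.mkCLM ℂ (OSPre c)).comp (preOp c S hS))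
    fun _ _ h => SeparationQuotient.mk_eq_mk.mpr (preOp_inseparable c S hS h)

/-- `quotOp` acts as `S` on classes. [folklore] -/
@[simp] theorem quotOp_mk (x : OSPre c) :
    quotOp c S hS (SeparationQuotient.mk x) = SeparationQuotient.mk (OSPre.endo c S x) := by
  simp [quotOp]

/-- **The OS operator** on `𝓗`: the extension of the contraction to the completion.
[cite: GlimmJaffe1987, §6.1 Thm. 6.1.3] -/
def osOperator : OSHilbert c →L[ℂ] OSHilbert c := (quotOp c S hS).completion

/-- **`ι` intertwines `S` and the OS operator**: `T (ι v) = ι (S v)`. [cite: GlimmJaffe1987, §6.1 Thm. 6.1.3] -/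
@[simp] theorem osOperator_osMap (v : V) : osOperator c S hS (osMap c v) = osMap c (S v) := by
  rw [osMap_apply, osMap_apply, osOperator, ContinuousLinearMap.completion_apply_coe, quotOp_mk]
  rfl

/-- The OS operator on the dense image of the quotient. [folklore] -/
theorem osOperator_coe_mk (x : OSPre c) :
    osOperator c S hS ((SeparationQuotient.mk x : SeparationQuotient (OSPre c)) : OSHilbert c) =
      ((SeparationQuotient.mk (OSPre.endo c S x) : SeparationQuotient (OSPre c)) : OSHilbert c) := by
  rw [osOperator, ContinuousLinearMap.completion_apply_coe, quotOp_mk]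

/-- **The OS operator is a contraction**: `‖T x‖ ≤ ‖x‖`. [cite: GlimmJaffe1987, §6.1 Thm. 6.1.3 (iii)] -/
theorem norm_osOperator_apply_le (x : OSHilbert c) : ‖osOperator c S hS x‖ ≤ ‖x‖ := by
  induction x using Completion.induction_on with
  | hp => exact isClosed_le (osOperator c S hS).continuous.norm continuous_norm
  | ih q =>
    obtain ⟨x, rfl⟩ := SeparationQuotient.surjective_mk q
    rw [osOperator_coe_mk, Completion.norm_coe, Completion.norm_coe, SeparationQuotient.norm_mk,
      SeparationQuotient.norm_mk]
    exact hS x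

/-- `‖T‖ ≤ 1`. [cite: GlimmJaffe1987, §6.1 Thm. 6.1.3 (iii)] -/
theorem norm_osOperator_le_one : ‖osOperator c S hS‖ ≤ 1 :=
  ContinuousLinearMap.opNorm_le_bound _ zero_le_one fun x => by
    simpa using norm_osOperator_apply_le c S hS x

/-- **The OS operator is symmetric** when `S` is symmetric for the form. [cite: GlimmJaffe1987, §6.1 Thm. 6.1.3 (ii)] -/
theorem osOperator_symm (hsymm : ∀ u v : V, c.inner (S u) v = c.inner u (S v)) (x y : OSHilbert c) :
    ⟪osOperator c S hS x, y⟫_ℂ = ⟪x, osOperator c S hS y⟫_ℂ := by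
  induction x, y using Completion.induction_on₂ with
  | hp =>
    exact isClosed_eq (Continuous.inner ((osOperator c S hS).continuous.comp continuous_fst) continuous_snd)
      (Continuous.inner continuous_fst ((osOperator c S hS).continuous.comp continuous_snd))
  | ih p q =>
    obtain ⟨x, rfl⟩ := SeparationQuotient.surjective_mk p
    obtain ⟨y, rfl⟩ := SeparationQuotient.surjective_mk q
    rw [osOperator_coe_mk, osOperator_coe_mk, Completion.inner_coe, Completion.inner_coe,
      SeparationQuotient.inner_mk_mk, SeparationQuotient.inner_mk_mk]
    exact hsymm x y

/-- **The OS operator is positive** when `S` is symmetric and `0 ≤ re c.inner (S v) v` (e.g. `S` a square of a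
symmetric map, or a one-step translation of a measure that is reflection positive about both integer and
half-integer hyperplanes). [cite: GlimmJaffe1987, §6.1 Thm. 6.1.3 (ii)] -/
theorem osOperator_isPositive (hsymm : ∀ u v : V, c.inner (S u) v = c.inner u (S v))
    (hpos : ∀ v : V, 0 ≤ RCLike.re (c.inner (S v) v)) : (osOperator c S hS).IsPositive := by
  refine ⟨fun x y => osOperator_symm c S hS hsymm x y, fun x => ?_⟩
  rw [ContinuousLinearMap.reApplyInnerSelf_apply]
  induction x using Completion.induction_on with
  | hp =>
    exact isClosed_le continuous_const
      (RCLike.continuous_re.comp (Continuous.inner ((osOperator c S hS).continuous) continuous_id))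
  | ih q =>
    obtain ⟨x, rfl⟩ := SeparationQuotient.surjective_mk q
    rw [osOperator_coe_mk, Completion.inner_coe, SeparationQuotient.inner_mk_mk]
    exact hpos x

end Operator

/-! ### Assembly: `TransferData` from symmetry, bounded orbits, positivity and an invariant unit vector -/

section Transfer

variable (c : PreInnerProductSpace.Core ℂ V) (S : V →ₗ[ℂ] V)

/-- **Symmetry + bounded orbits ⇒ contraction** for the OS seminorm (the iterated Schwarz inequality applied in
`OSPre c`). [cite: GlimmJaffe1987, §6.1 Thm. 6.1.3 (iii)] -/
theorem norm_endo_le (hsymm : ∀ u v : V, c.inner (S u) v = c.inner u (S v))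
    (hbdd : ∀ v : V, ∃ C : ℝ, ∀ n : ℕ, RCLike.re (c.inner ((S ^ n) v) ((S ^ n) v)) ≤ C)
    (x : OSPre c) : ‖OSPre.endo c S x‖ ≤ ‖x‖ := by
  obtain ⟨C, hC⟩ := hbdd x
  have hsymm' : ∀ x y : OSPre c, ⟪OSPre.endo c S x, y⟫_ℂ = ⟪x, OSPre.endo c S y⟫_ℂ := fun x y => hsymm x y
  refine norm_map_le_of_symm_of_orbitBounded hsymm' x (C := Real.sqrt C) fun n => ?_
  have hpow : (OSPre.endo c S ^ n) x = OSPre.of c ((S ^ n) x) := by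
    induction n with
    | zero => rfl
    | succ n ih => rw [pow_succ', Module.End.mul_apply, ih, pow_succ', Module.End.mul_apply]; rfl
  rw [hpow, ← Real.sqrt_sq (norm_nonneg _)]
  refine Real.sqrt_le_sqrt ?_
  rw [← @inner_self_eq_norm_sq ℂ, OSPre.inner_of]
  exact hC n

/-- **The reconstructed transfer data** `(T, Ω) = (osOperator, ι e)`: from a positive-semidefinite Hermitian form, a
symmetric orbit-bounded endomorphism `S` with `0 ≤ re c.inner (S v) v`, and an `S`-invariant vector `e` of unit
"norm", one obtains `TransferData` on the OS Hilbert space — positive contraction fixing the unit vacuum.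
[cite: GlimmJaffe1987, §6.1 Thm. 6.1.3] -/
def osTransferData (hsymm : ∀ u v : V, c.inner (S u) v = c.inner u (S v))
    (hbdd : ∀ v : V, ∃ C : ℝ, ∀ n : ℕ, RCLike.re (c.inner ((S ^ n) v) ((S ^ n) v)) ≤ C)
    (hpos : ∀ v : V, 0 ≤ RCLike.re (c.inner (S v) v)) (e : V) (he : S e = e) (he1 : c.inner e e = 1) :
    TransferData (OSHilbert c) where
  T := osOperator c S (norm_endo_le c S hsymm hbdd)
  vacuum := osMap c e
  isPositive := osOperator_isPositive c S _ hsymm hpos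
  norm_le_one := norm_osOperator_le_one c S _
  map_vacuum := by rw [osOperator_osMap, he]
  norm_vacuum := by
    have h := norm_osMap_sq c e
    rw [he1, RCLike.one_re] at h
    have h0 : 0 ≤ ‖osMap c e‖ := norm_nonneg _
    nlinarith [h, h0]

/-- The transfer operator of `osTransferData` is intertwined with `S` by `ι`. [folklore] -/
@[simp] theorem osTransferData_T_osMap (hsymm : ∀ u v : V, c.inner (S u) v = c.inner u (S v))
    (hbdd : ∀ v : V, ∃ C : ℝ, ∀ n : ℕ, RCLike.re (c.inner ((S ^ n) v) ((S ^ n) v)) ≤ C)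
    (hpos : ∀ v : V, 0 ≤ RCLike.re (c.inner (S v) v)) (e : V) (he : S e = e) (he1 : c.inner e e = 1)
    (v : V) : (osTransferData c S hsymm hbdd hpos e he he1).T (osMap c v) = osMap c (S v) :=
  osOperator_osMap c S _ v

/-- The vacuum of `osTransferData` is `ι e`. [folklore] -/
@[simp] theorem osTransferData_vacuum (hsymm : ∀ u v : V, c.inner (S u) v = c.inner u (S v))
    (hbdd : ∀ v : V, ∃ C : ℝ, ∀ n : ℕ, RCLike.re (c.inner ((S ^ n) v) ((S ^ n) v)) ≤ C)
    (hpos : ∀ v : V, 0 ≤ RCLike.re (c.inner (S v) v)) (e : V) (he : S e = e) (he1 : c.inner e e = 1) :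
    (osTransferData c S hsymm hbdd hpos e he he1).vacuum = osMap c e := rfl

end Transfer

end Literature.Probability.LatticeModels
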